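import Summits.BirchSwinnertonDyer.BirchSwinnertonDyer.Theorems.GoldfeldAllTwistsTwoConverseTwinAdditiveTwoPrimesTwistSelmerPOne
import HarnessLib

set_option linter.dupNamespace false -- namespace `…BirchSwinnertonDyer.BirchSwinnertonDyer…` is the cell's (D-0017 nested layout)
set_option autoImplicit false

/-!
# Twin″ (item 19140), β cell with `q ≡ 3 (mod 8)`, `p ≡ 1 (mod 8)`, TRANCHE C5-F file T0′: the `2`-adic kills of the four classes
# `−qp, 7qp, −2qp, 14qp` of `S′ = S(84qp, −28q²p²)` for `49a1^{(−2qp)}` at `(q, p) ≡ (3, 1) (mod 8)`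

Cell `bsd-goldfeld`, seat `bsd-goldfeld-s1p-c3x` (gen 14); planner RULING (ccclxxv) «CONDITIONAL TRANCHE C5-F» (formula axis of the β cell
`q ≡ 3 (8)`, `p ≡ 1 (8)`, `(p/q) = −1`), first file. `--supports stmt-BirchSwinnertonDyer-19140` as a HELPER. FACT-FREE: no print binder,
no definition, no `sorry`.

THE SHAPE. For `W = 49a1^{(−2qp)}` (model `E = ⟨0, −42qp, 0, 448q²p², 0⟩`, `E′ = ⟨0, 84qp, 0, −28q²p², 0⟩`) the kit (j321631/j321755) finds
`(S, S′) = ({1, 7}, {1, −7, 2, −14})` = `(2, 4)` on every row with `q ≡ 3 (8)`, `p ≡ 1 (8)`, type β, `(p/q) = −1`: versus cell C7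
(`q ≡ 7 (8)`, F9a/F9b: `S′ = {1, −7, −qp, 7qp}`) the classes `2, −14` of `S′` now SURVIVE and `−qp, 7qp` DIE at `2`. This file supplies the
`2`-adic kills of exactly the four classes `−qp, 7qp, −2qp, 14qp` of `S′`: since `p ≡ 1 (mod 8)` and `3q ≡ 1 (mod 8)`, the landed rescaling
`isSoluble_two_of_common_factor` (`n ↦ n₀` with `n n₀ ∈ 1 + 8ℤ`: `p ↦ 1`, `q ↦ 3`) carries them to the numeric quartics
`(252; −3, 84)`, `(252; 21, −12)`, `(252; −6, 42)` (and the swap of the last), each of which dies in both `ℤ₂`-charts modulo `2⁶`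
(`decide`; chart lemmas `not_isSoluble_two_of_padicInt_charts`, `padicInt_two_sq_ne_of_zmodPow` of `…TwinEvenTwistTwoAdic`) — word for
word F9a §2 (`…TwinAdditiveTwoPrimesTwistSelmerPOne`) with `q₀ = 3` in place of `q₀ = −1`.
HONEST FRAMING: local lemmas; no `BSD(W,2)` is proved; BSD is not proved by any of this; item 19140 stays open.

References: [SilvermanAEC2009] Prop. X.4.9, Example X.4.10; [Serre1973] Ch. II §3.3 Thm 4.
-/

noncomputable section

open scoped Classical

open WeierstrassCurve Literature.NumberTheory.EllipticCurves

namespace Summit.BirchSwinnertonDyer.BirchSwinnertonDyer.Theorems.GoldfeldGoodTwists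

/-! ## §1 The three numeric quartics die modulo `2⁶` in both charts -/

/-- `ℤ/2⁶` keys for `(252; −3, 84)`: both charts die modulo `64`. [folklore] -/
private theorem keys_threeOne_negQP :
    (∀ T S : ZMod (2 ^ 6), S ^ 2 ≠ ((-3 : ℤ) : ZMod (2 ^ 6)) + ((252 : ℤ) : ZMod (2 ^ 6)) * T ^ 2 +
      ((84 : ℤ) : ZMod (2 ^ 6)) * T ^ 4) ∧
    (∀ T S : ZMod (2 ^ 6), S ^ 2 ≠ ((84 : ℤ) : ZMod (2 ^ 6)) + ((252 : ℤ) : ZMod (2 ^ 6)) * T ^ 2 +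
      ((-3 : ℤ) : ZMod (2 ^ 6)) * T ^ 4) := by
  refine ⟨?_, ?_⟩ <;> decide +kernel

/-- `ℤ/2⁶` keys for `(252; 21, −12)`: both charts die modulo `64`. [folklore] -/
private theorem keys_threeOne_sevenQP :
    (∀ T S : ZMod (2 ^ 6), S ^ 2 ≠ ((21 : ℤ) : ZMod (2 ^ 6)) + ((252 : ℤ) : ZMod (2 ^ 6)) * T ^ 2 +
      ((-12 : ℤ) : ZMod (2 ^ 6)) * T ^ 4) ∧
    (∀ T S : ZMod (2 ^ 6), S ^ 2 ≠ ((-12 : ℤ) : ZMod (2 ^ 6)) + ((252 : ℤ) : ZMod (2 ^ 6)) * T ^ 2 +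
      ((21 : ℤ) : ZMod (2 ^ 6)) * T ^ 4) := by
  refine ⟨?_, ?_⟩ <;> decide +kernel

/-- `ℤ/2⁶` keys for `(252; −6, 42)`: both charts die modulo `64`. [folklore] -/
private theorem keys_threeOne_negTwoQP :
    (∀ T S : ZMod (2 ^ 6), S ^ 2 ≠ ((-6 : ℤ) : ZMod (2 ^ 6)) + ((252 : ℤ) : ZMod (2 ^ 6)) * T ^ 2 +
      ((42 : ℤ) : ZMod (2 ^ 6)) * T ^ 4) ∧
    (∀ T S : ZMod (2 ^ 6), S ^ 2 ≠ ((42 : ℤ) : ZMod (2 ^ 6)) + ((252 : ℤ) : ZMod (2 ^ 6)) * T ^ 2 +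
      ((-6 : ℤ) : ZMod (2 ^ 6)) * T ^ 4) := by
  refine ⟨?_, ?_⟩ <;> decide +kernel

/-- **Numeric kill `(252; −3, 84)`**: `w² = −3u⁴ + 252u²z² + 84z⁴` has no non-trivial `ℚ₂`-point (both charts die modulo `2⁶`).
[cite: SilvermanAEC2009, Prop. X.4.9 and Example X.4.10] -/
theorem not_isSoluble_two_normalised_negQP_threeOne :
    ¬ ((twoIsogenyQuartic 252 (-3) 84).map (Int.castRingHom ℚ_[2])).IsSoluble := by
  obtain ⟨c, c'⟩ := keys_threeOne_negQP
  exact not_isSoluble_two_of_padicInt_charts (padicInt_two_sq_ne_of_zmodPow 6 c) (padicInt_two_sq_ne_of_zmodPow 6 c')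

/-- **Numeric kill `(252; 21, −12)`**: `w² = 21u⁴ + 252u²z² − 12z⁴` has no non-trivial `ℚ₂`-point (both charts die modulo `2⁶`).
[cite: SilvermanAEC2009, Prop. X.4.9 and Example X.4.10] -/
theorem not_isSoluble_two_normalised_sevenQP_threeOne :
    ¬ ((twoIsogenyQuartic 252 21 (-12)).map (Int.castRingHom ℚ_[2])).IsSoluble := by
  obtain ⟨c, c'⟩ := keys_threeOne_sevenQP
  exact not_isSoluble_two_of_padicInt_charts (padicInt_two_sq_ne_of_zmodPow 6 c) (padicInt_two_sq_ne_of_zmodPow 6 c')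

/-- **Numeric kill `(252; −6, 42)`**: `w² = −6u⁴ + 252u²z² + 42z⁴` has no non-trivial `ℚ₂`-point (both charts die modulo `2⁶`).
[cite: SilvermanAEC2009, Prop. X.4.9 and Example X.4.10] -/
theorem not_isSoluble_two_normalised_negTwoQP_threeOne :
    ¬ ((twoIsogenyQuartic 252 (-6) 42).map (Int.castRingHom ℚ_[2])).IsSoluble := by
  obtain ⟨c, c'⟩ := keys_threeOne_negTwoQP
  exact not_isSoluble_two_of_padicInt_charts (padicInt_two_sq_ne_of_zmodPow 6 c) (padicInt_two_sq_ne_of_zmodPow 6 c')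

/-! ## §2 The four classes `−qp, 7qp, −2qp, 14qp` of `S′ = S(84qp, −28q²p²)` at `(q, p) ≡ (3, 1) (mod 8)` -/

section Classes
variable {q p : ℕ}

/-- Engine, common-factor type: `d = pq·d₁`, `d′ = pq·e₁` ⇒ after `p ↦ 1` (`p ≡ 1 (8)`) and `q ↦ 3` (`q ≡ 3 (8)`) the class is the numeric
quartic `(3·84; 3d₁, 3e₁)`. [cite: Serre1973, Ch. II §3.3 Thm 4] -/
private theorem kill_common_threeOne (hq8 : q % 8 = 3) (hp8 : p % 8 = 1) {a d d' d₁ e₁ : ℤ}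
    (ha : a = 84 * ((q : ℤ) * p)) (hd : d = p * (q * d₁)) (hd' : d' = p * (q * e₁))
    (hk : ¬ ((twoIsogenyQuartic (3 * 84) (3 * d₁) (3 * e₁)).map (Int.castRingHom ℚ_[2])).IsSoluble) :
    ¬ ((twoIsogenyQuartic a d d').map (Int.castRingHom ℚ_[2])).IsSoluble := fun h ↦ by
  have h1 := isSoluble_two_of_common_factor (n := p) (n₀ := 1) (by omega) (a₀ := 84 * q) (d₀ := q * d₁) (e₀ := q * e₁)
    (by rw [ha]; ring) hd hd' h
  exact hk (isSoluble_two_of_common_factor (n := q) (n₀ := 3) (by omega) (a₀ := 84) (d₀ := d₁) (e₀ := e₁) (by ring) (by ring)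
    (by ring) h1)

/-- **Class `−qp` of `S′`** (`d′ = 28qp`), `(q, p) ≡ (3, 1) (mod 8)`: no `ℚ₂`-point. [cite: SilvermanAEC2009, Prop. X.4.9 and Example X.4.10] -/
theorem not_isSoluble_two_dual_negQP_threeOne (hq8 : q % 8 = 3) (hp8 : p % 8 = 1) {a d d' : ℤ} (ha : a = 84 * ((q : ℤ) * p))
    (hd : d = -((q : ℤ) * p)) (hd' : d' = 28 * ((q : ℤ) * p)) :
    ¬ ((twoIsogenyQuartic a d d').map (Int.castRingHom ℚ_[2])).IsSoluble :=
  kill_common_threeOne hq8 hp8 ha (d₁ := -1) (e₁ := 28) (by rw [hd]; ring) (by rw [hd']; ring)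
    (by norm_num; exact not_isSoluble_two_normalised_negQP_threeOne)

/-- **Class `7qp` of `S′`** (`d′ = −4qp`), `(q, p) ≡ (3, 1) (mod 8)`: no `ℚ₂`-point. [cite: SilvermanAEC2009, Prop. X.4.9 and Example X.4.10] -/
theorem not_isSoluble_two_dual_sevenQP_threeOne (hq8 : q % 8 = 3) (hp8 : p % 8 = 1) {a d d' : ℤ} (ha : a = 84 * ((q : ℤ) * p))
    (hd : d = 7 * ((q : ℤ) * p)) (hd' : d' = -4 * ((q : ℤ) * p)) :
    ¬ ((twoIsogenyQuartic a d d').map (Int.castRingHom ℚ_[2])).IsSoluble :=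
  kill_common_threeOne hq8 hp8 ha (d₁ := 7) (e₁ := -4) (by rw [hd]; ring) (by rw [hd']; ring)
    (by norm_num; exact not_isSoluble_two_normalised_sevenQP_threeOne)

/-- **Class `−2qp` of `S′`** (`d′ = 14qp`), `(q, p) ≡ (3, 1) (mod 8)`: no `ℚ₂`-point. [cite: SilvermanAEC2009, Prop. X.4.9 and Example X.4.10] -/
theorem not_isSoluble_two_dual_negTwoQP_threeOne (hq8 : q % 8 = 3) (hp8 : p % 8 = 1) {a d d' : ℤ} (ha : a = 84 * ((q : ℤ) * p))
    (hd : d = -2 * ((q : ℤ) * p)) (hd' : d' = 14 * ((q : ℤ) * p)) :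
    ¬ ((twoIsogenyQuartic a d d').map (Int.castRingHom ℚ_[2])).IsSoluble :=
  kill_common_threeOne hq8 hp8 ha (d₁ := -2) (e₁ := 14) (by rw [hd]; ring) (by rw [hd']; ring)
    (by norm_num; exact not_isSoluble_two_normalised_negTwoQP_threeOne)

/-- **Class `14qp` of `S′`** (`d′ = −2qp`), `(q, p) ≡ (3, 1) (mod 8)`: no `ℚ₂`-point. [cite: SilvermanAEC2009, Prop. X.4.9 and Example X.4.10] -/
theorem not_isSoluble_two_dual_fourteenQP_threeOne (hq8 : q % 8 = 3) (hp8 : p % 8 = 1) {a d d' : ℤ} (ha : a = 84 * ((q : ℤ) * p))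
    (hd : d = 14 * ((q : ℤ) * p)) (hd' : d' = -2 * ((q : ℤ) * p)) :
    ¬ ((twoIsogenyQuartic a d d').map (Int.castRingHom ℚ_[2])).IsSoluble := by
  rw [isSoluble_map_twoIsogenyQuartic_comm]
  exact not_isSoluble_two_dual_negTwoQP_threeOne hq8 hp8 ha hd' hd

end Classes

end Summit.BirchSwinnertonDyer.BirchSwinnertonDyer.Theorems.GoldfeldGoodTwists

end
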